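import Literature.MathematicalPhysics.QuantumFieldTheory.Balaban1983to89.B8Eq1117KLevel

/-!
# `Balaban1983to89.B8Claim97KLevel` — [Balaban1985RegularSpaces] Sect. E p. 97 AT `k` LEVELS: the ONTO SENTENCE «the mapping (1.113)
# transforms the set {λ: |λ| < ½α₄, |Dλ| < ½α₄(Lʲη)⁻¹ on Ω_j} onto a set containing {λ′: |λ′| < ¼α₄, |Dλ′| < ¼α₄(Lʲη)⁻¹ on Ω_j}»
# over a nested pair `(Ω, Λ)` with region-dependent (tower-local) hypotheses, BY THE EXPLICIT INVERSE `λ = λ′ + H′C′(λ′)` of (1.113)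

statement-level skeleton of published theorems with citation tags; proofs where landed; nothing here is a claim about the Yang–Mills mass gap

T. Bałaban, *Spaces of regular gauge field configurations on a lattice and gauge fixing conditions*, Commun.
Math. Phys. **99** (1985) 75–102 `[Balaban1985RegularSpaces]` ("B8"; printed page = PDF page + 74), pp. 95–97 [PDF 21–23];
[3] = [Balaban1985Averaging], (213)–(214) p. 50.  PDF held: `paper:balaban1985-cmp99-regular-spaces-gauge-fixing`.  STATUS: published,
refereed.

CITATION HEADER (lean-in-tree rule).  Cell `pub-ymgap` (YM Track A, DAG node N05 = [B8], HUMAN RULING D-0062), seat `pub-ymgap-dag-n05-b`,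
gen 0 («Sect. E at k levels»).  WHAT IS REPRODUCED = SKELETON row **B8.Claim@97** (the p. 97 onto sentence) in the REGION-DEPENDENT form:
the tree has it abstractly (`B8Claim97OntoProof.linMap_onto_quarter`, r05, by a second contraction) and concretely at ONE level
(`B8Eq1119LambdaSpace.onto_concrete`, weight `w = Lᵏ`); here AT `k` LEVELS for the concrete remainder `C′_j(u₁, ·)` read on `𝔅_k`, with an
ELEMENTARY proof that needs no λ-space: by (1.116)/(1.117), `D′(λ) = C′(λ − H′D′(λ)) = C′(λ′)` for `λ′ = λ − H′D′(λ)`, so the inverse of the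
transformation (1.113) is EXPLICIT, `λ = λ′ + H′C′(λ′)`; given `λ′` in the quarter-size set one puts `X₀ := C′(λ′)` (masked to `𝔅_k`),
`λ := λ′ + H′X₀`, and checks: `X₀` lies in the ball (by (1.121) and print's smallness, `‖X₀‖ ≤ C′₂(α₃ + α₄)α₄ ≤ α₄/(8B′₀)`), `X₀` solves (1.117)
for `λ` (as `λ − H′X₀ = λ′`), hence `X₀ = D′(λ)` by «exactly one solution» (`B8Eq1117KLevel.eq1117_existsUnique_kLevel`), `λ` lies in the
half-size set (`¼α₄ + B′₀‖X₀‖ ≤ ¼α₄ + ⅛α₄ < ½α₄`, sites and bonds), and `λ − H′D′(λ) = λ′`.  INPUTS BY NAME: `B8Eq1117KLevel.{norm_Cnl_le_tower,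
eq1117_existsUnique_kLevel, glev_on_towers_of_axial}`, `B7Eq170Flat.cj_add`, `B8Eq1123Concrete.Cnl`, `B8Eq1117Concrete.XSpace`.  Kind
«kernel-checked proof», theorems only: no `def`, no `… : Prop` fact, no existing module modified.

## THE PRINTED TEXT (p. 97 [PDF 23])

«We take D′(λ) equal to this solution. From Eq. (1.116) we can get much better bounds on it: |D′(λ)| = |C′(λ − H′D′(λ))| < C′₂(α₃ + α₄)α₄.
They imply in particular that the mapping (1.113) transforms the set {λ: |λ| < ½α₄, |Dλ| < ½α₄(Lʲη)⁻¹ on Ω_j} onto a set containing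
{λ′: |λ′| < ¼α₄, |Dλ′| < ¼α₄(Lʲη)⁻¹ on Ω_j} for α₃, α₄ sufficiently small.»

## WHAT IS CERTIFIED HERE (kernel; axioms `propext` / `Classical.choice` / `Quot.sound`)

Setting of `B8Eq1117KLevel.eq1117_existsUnique_kLevel` (tower-local (1.33)/(1.69)/`u₁ = glev_j`/H′-modulus on every `Bʲ(y)`, `y ∈ Λ_j`,
`j ≤ k`; global `‖(H′X)(x)‖ ≤ B′₀‖X‖`; the `j`-free smallness at `2α₄`; print's «α₃ + α₄ ≦ 1/(4B′₀C′₂)», `α₃ = 40d·c`, `C′₂ := 2·C2p d`).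
* §1 `exists_masked_Cnl` — for `λ′` in the FULL-size set (1.120) on the towers, the masked family `X₀(j, y) = C′_j(u₁, λ′)(y)` (`y ∈ Λ_j`),
  `0` off `𝔅_k`, is an element of `XSpace d k 𝔸` with `‖X₀‖ ≤ C2p(α₃ + α₄)α₄` ((1.121) at every point, `norm_Cnl_le_tower`).
* §2 **`onto_kLevel`** — THE ONTO SENTENCE AT `k` LEVELS: for every `λ′` with `‖λ′(x)‖ < ¼α₄` at the sites and `‖R(U₀(b))λ′(b₊) − λ′(b₋)‖ <
  ¼α₄L^{−j}` on the bonds of every tower `Bʲ(y)`, `y ∈ Λ_j`, there are `λ` and `X` with: `λ` in the half-size set (1.119) on every tower,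
  `X` in the ball `‖X‖ ≤ α₄/(2B′₀)`, `X = 0` off `𝔅_k`, `X` solves (1.117) for `λ` on `𝔅_k` (so `X = D′(λ)` by `eq1117_existsUnique_kLevel`),
  and `λ − H′X = λ′` — i.e. `λ′` is the image of `λ` under (1.113); **`onto_kLevel_of_axial`** — the same with `u₁ = glev_j on Bʲ(Λ_j)`
  discharged from `InAx`/`Restr129`.
* §3 `eq1114_inverse_kLevel` — (1.114) through the inverse: with `Q′H′ = I` on `𝔅_k`, `Q′_j(u₁, λ′)(y) = (Q′_j(λ′ + H′X₀))(y)` on `𝔅_k` for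
  EVERY `λ′` («changes the function Q′(λ′) into the linear function Q′λ», p. 95).

## HONEST SCOPE — what is NOT claimed

(i) Print says «for α₃, α₄ sufficiently small»; here print's own contraction condition «α₃ + α₄ ≦ 1/(4B′₀C′₂)» (with the lineage's
`C′₂ := 2·C2p`) suffices — no halving is needed for the explicit inverse (r05's abstract route needed `1/(8B′₀C′₂)`).  (ii) The explicit
inverse `λ = λ′ + H′C′(λ′)` is a one-line consequence of (1.116)–(1.117), not a sentence of print; it replaces print's unstated argument.
(iii) `<` inputs, `<`/`≤` outputs as typed; `ℤᵈ` carriers; `H′` abstract (interface I-B8-2); nothing on analyticity.  Nothing here is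
progress on the summit.
-/

noncomputable section

open NormedSpace Finset

namespace Literature.MathematicalPhysics.QuantumFieldTheory.Balaban1983to89.B8Claim97KLevel

open B7Prop1Explicit B7Prop2Explicit B7Prop3Flat B7Prop1Local B7Eq167Flat B7Eq167General
open B7Eq170Flat (cj cj_apply cj_add)
open B7Prop10General (C6 C4G)
open B7Prop10Flat (one_le_C5 C4'_nonneg C5'_nonneg)
open B7Prop9Flat (C5')
open B7Eq214General (Cgen)
open B8Ineq130 (tlo thi)
open B7Eq84Concrete (glev)
open B7Eq92Concrete (mgauge)
open B7Eq78Linearization (zdBlocking QprimeIter)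
open B8Eq119TwistedAxial (bgT InAx Restr129)
open B8Eq178Averages (Qnl)
open B8Eq1123Concrete (Cnl QprimeIter_line)
open B8Ineq125Concrete (C2p C2p_nonneg)
open B8Eq1117Concrete (XSpace)
open B8Eq1117KLevel (norm_Cnl_le_tower glev_on_towers_of_axial)

-- `Site` alone could resolve to the torus sites of `Setup.lean`; re-export the `ℤ^d` sites of `B7Prop1Explicit`.
export B7Prop1Explicit (Site)

variable {d : ℕ}

variable {𝔸 : Type*} [NormedRing 𝔸] [NormOneClass 𝔸] [NormedAlgebra ℂ 𝔸] [CompleteSpace 𝔸]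

/-! ## §1 The masked family `C′(λ′)|_{𝔅_k}` as an element of the `X`-space -/

/-- **`X₀ := C′(λ′)` ON `𝔅_k`** (the explicit value `D′(λ) = C′(λ′)` of (1.116)–(1.117)): for `λ′` in the full-size set (1.120) on every
tower (`‖λ′(x)‖ < α₄`, `‖R(U₀(b))λ′(b₊) − λ′(b₋)‖ < α₄L^{−j}`), under the tower-local hypotheses and the `j`-free smallness of
`B8Eq1117KLevel.norm_Cnl_le_tower`, there is `X₀ ∈ XSpace d k 𝔸` with `X₀(j, y) = C′_j(u₁, λ′)(y)` for `y ∈ Λ_j`, `X₀(j, y) = 0` for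
`y ∉ Λ_j`, and `‖X₀‖ ≤ C2p·(α₃ + α₄)·α₄` ((1.121)). [cite: Balaban1985RegularSpaces, (1.116)–(1.117) p.96, (1.121) p.96] -/
theorem exists_masked_Cnl {L : ℕ} (hL : 2 ≤ L) (hL1 : 1 ≤ L) {G : Subgroup 𝔸ˣ} (hG : AvgClosed d L G)
    {U₀ : Site d → Fin d → 𝔸ˣ} (hU₀ : ∀ x κ, U₀ x κ ∈ G) (k : ℕ) (Λ : ℕ → Set (Site d))
    (lam' : Site d → 𝔸) {B : Site d → Fin d → 𝔸} {u₁ : Site d → 𝔸ˣ} {α₀ α₄ c : ℝ}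
    (hα : 0 < α₀) (hα3 : C0 d * α₀ ≤ 1 / 3) (hα4 : 4 * α₀ ≤ c2' d L) (hc : 0 ≤ c) (hα₄ : 0 < α₄)
    (h33 : ∀ j, j ≤ k → ∀ y ∈ Λ j, pdevOn (tlo L y j) (thi L y j) U₀ < α₀ * (((L : ℝ) ^ j)⁻¹) ^ 2)
    (h69 : ∀ j, j ≤ k → ∀ y ∈ Λ j, ∀ (x : Site d) (κ : Fin d), InBox (tlo L y j) (thi L y j) x →
      InBox (tlo L y j) (thi L y j) (x + e κ) → ‖B x κ‖ ≤ c * ((L : ℝ) ^ j)⁻¹)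
    (hu₁ : ∀ j, j ≤ k → ∀ y ∈ Λ j, ∀ x : Site d, tlo L y j ≤ x → x ≤ thi L y j → u₁ x = glev L hL1 U₀ (expCfg B) j 0 x)
    (hb : ∀ j, j ≤ k → ∀ y ∈ Λ j, ∀ x : Site d, InBox (tlo L y j) (thi L y j) x → ‖lam' x‖ < α₄)
    (ha : ∀ j, j ≤ k → ∀ y ∈ Λ j, ∀ (x : Site d) (κ : Fin d), InBox (tlo L y j) (thi L y j) x →
      InBox (tlo L y j) (thi L y j) (x + e κ) → ‖cj (U₀ x κ) (lam' (x + e κ)) - lam' x‖ < α₄ * ((L : ℝ) ^ j)⁻¹)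
    (hsmall : Real.exp (4 * (800 * ((d : ℝ) + 1) ^ 2 * ((d : ℝ) + 4)) * α₀) * (1 + 8 * (131072 * ((d : ℝ) + 1) ^ 2) * c) ≤ 2)
    (hc₃ : 2 * c ≤ c3 d L) (hs : 128 * (d : ℝ) * c ≤ 1) (hα₃' : 40 * d * c ≤ 1 / 200)
    (hs₁ : 200 * C6 d * α₄ ≤ 1) (hs₂ : 12000 * ((d : ℝ) + 1) * L * α₄ ≤ 1)
    (hs₃ : C4G d L * (α₀ + 40 * d * c + 4 * α₄) ≤ 1)
    (hs₄ : 1024 * ((d : ℝ) + 1) * ((d : ℝ) + 4) * L ^ 2 * α₀ ≤ 1) (hs₅ : 32 * ((d : ℝ) + 1) ^ 2 * C6 d * L ^ 2 * α₀ ≤ 1)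
    (hs₆ : 16 * d * C5' d * C6 d * (L : ℝ) ^ 2 * α₀ ≤ 1) (hs₇ : 8 * d * C6 d * L * α₀ ≤ 1) :
    ∃ X₀ : XSpace d k 𝔸, ‖X₀‖ ≤ C2p d * (40 * d * c + α₄) * α₄ ∧
      (∀ (j : ℕ) (hj : j ≤ k) (y : Site d), y ∉ Λ j → X₀ (⟨j, Nat.lt_succ_of_le hj⟩, y) = 0) ∧
      ∀ (j : ℕ) (hj : j ≤ k) (y : Site d), y ∈ Λ j → X₀ (⟨j, Nat.lt_succ_of_le hj⟩, y) = Cnl L U₀ u₁ j lam' y := by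
  classical
  have hC2 : 0 ≤ C2p d := C2p_nonneg d
  let F : Fin (k + 1) × Site d → 𝔸 := fun p => if p.2 ∈ Λ p.1 then Cnl L U₀ u₁ p.1 lam' p.2 else 0
  have hF : ∀ p, ‖F p‖ ≤ C2p d * (40 * d * c + α₄) * α₄ := by
    intro p
    simp only [F]
    split_ifs with hp
    · exact norm_Cnl_le_tower hL hG hU₀ hα hα3 hα4 (h33 p.1 (Nat.le_of_lt_succ p.1.isLt) p.2 hp) hc
        (h69 p.1 (Nat.le_of_lt_succ p.1.isLt) p.2 hp) hsmall hc₃ hs hL1 (hu₁ p.1 (Nat.le_of_lt_succ p.1.isLt) p.2 hp) hα₄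
        (hb p.1 (Nat.le_of_lt_succ p.1.isLt) p.2 hp) (ha p.1 (Nat.le_of_lt_succ p.1.isLt) p.2 hp) hα₃' hs₁ hs₂ hs₃ hs₄ hs₅ hs₆ hs₇
    · rw [norm_zero]; positivity
  refine ⟨BoundedContinuousFunction.ofNormedAddCommGroupDiscrete F _ hF, ?_, ?_, ?_⟩
  · exact (BoundedContinuousFunction.norm_le (by positivity)).2 fun p => hF p
  · intro j hj y hy
    show F _ = 0
    simp only [F, if_neg hy]
  · intro j hj y hy
    show F _ = _
    simp only [F, if_pos hy]

/-! ## §2 The onto sentence of p. 97 at `k` levels -/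

/-- **THE ONTO SENTENCE OF p. 97 AT `k` LEVELS** («the mapping (1.113) transforms the set {λ: |λ| < ½α₄, |Dλ| < ½α₄(Lʲη)⁻¹ on Ω_j} onto a set
containing {λ′: |λ′| < ¼α₄, |Dλ′| < ¼α₄(Lʲη)⁻¹ on Ω_j}»), by the explicit inverse `λ = λ′ + H′C′(λ′)`: in the setting of
`B8Eq1117KLevel.eq1117_existsUnique_kLevel`, for every `λ′` in the quarter-size set on every tower `Bʲ(y)`, `y ∈ Λ_j`, `j ≤ k`, there are `λ`,
`X` such that `λ` lies in the half-size set (1.119) on every tower, `‖X‖ ≤ α₄/(2B′₀)`, `X = 0` off `𝔅_k`, `X` solves (1.117) for `λ` on `𝔅_k`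
(`C′_j(u₁, λ − H′X)(y) = X(j, y)`, `y ∈ Λ_j` — so `X = D′(λ)` by «exactly one solution»), and `λ − H′X = λ′`.
[cite: Balaban1985RegularSpaces, p.97 (onto sentence), (1.113) p.95, (1.116)–(1.121) p.96] -/
theorem onto_kLevel {L : ℕ} (hL : 2 ≤ L) (hL1 : 1 ≤ L) {G : Subgroup 𝔸ˣ} (hG : AvgClosed d L G)
    {U₀ : Site d → Fin d → 𝔸ˣ} (hU₀ : ∀ x κ, U₀ x κ ∈ G) {k : ℕ} (Λ : ℕ → Set (Site d))
    (H' : XSpace d k 𝔸 →ₗ[ℂ] (Site d → 𝔸)) (lam' : Site d → 𝔸) {B : Site d → Fin d → 𝔸} {u₁ : Site d → 𝔸ˣ}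
    {α₀ α₄ c B₀' : ℝ}
    (hα : 0 < α₀) (hα3 : C0 d * α₀ ≤ 1 / 3) (hα4 : 4 * α₀ ≤ c2' d L) (hc : 0 ≤ c) (hα₄ : 0 < α₄) (hB : 0 < B₀')
    (h33 : ∀ j, j ≤ k → ∀ y ∈ Λ j, pdevOn (tlo L y j) (thi L y j) U₀ < α₀ * (((L : ℝ) ^ j)⁻¹) ^ 2)
    (h69 : ∀ j, j ≤ k → ∀ y ∈ Λ j, ∀ (x : Site d) (κ : Fin d), InBox (tlo L y j) (thi L y j) x →
      InBox (tlo L y j) (thi L y j) (x + e κ) → ‖B x κ‖ ≤ c * ((L : ℝ) ^ j)⁻¹)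
    (hu₁ : ∀ j, j ≤ k → ∀ y ∈ Λ j, ∀ x : Site d, tlo L y j ≤ x → x ≤ thi L y j → u₁ x = glev L hL1 U₀ (expCfg B) j 0 x)
    (hq_b : ∀ j, j ≤ k → ∀ y ∈ Λ j, ∀ x : Site d, InBox (tlo L y j) (thi L y j) x → ‖lam' x‖ < α₄ / 4)
    (hq_a : ∀ j, j ≤ k → ∀ y ∈ Λ j, ∀ (x : Site d) (κ : Fin d), InBox (tlo L y j) (thi L y j) x →
      InBox (tlo L y j) (thi L y j) (x + e κ) → ‖cj (U₀ x κ) (lam' (x + e κ)) - lam' x‖ < α₄ / 4 * ((L : ℝ) ^ j)⁻¹)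
    (hH0 : ∀ (X : XSpace d k 𝔸) (x : Site d), ‖H' X x‖ ≤ B₀' * ‖X‖)
    (hH1 : ∀ j, j ≤ k → ∀ y ∈ Λ j, ∀ (X : XSpace d k 𝔸) (x : Site d) (κ : Fin d), InBox (tlo L y j) (thi L y j) x →
      InBox (tlo L y j) (thi L y j) (x + e κ) → ‖cj (U₀ x κ) (H' X (x + e κ)) - H' X x‖ ≤ B₀' * ‖X‖ * ((L : ℝ) ^ j)⁻¹)
    (hsmall : Real.exp (4 * (800 * ((d : ℝ) + 1) ^ 2 * ((d : ℝ) + 4)) * α₀) * (1 + 8 * (131072 * ((d : ℝ) + 1) ^ 2) * c) ≤ 2)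
    (hc₃ : 2 * c ≤ c3 d L) (hs : 128 * (d : ℝ) * c ≤ 1) (hα₃' : 40 * d * c ≤ 1 / 200)
    (hs₁ : 200 * C6 d * (2 * α₄) ≤ 1) (hs₂ : 12000 * ((d : ℝ) + 1) * L * (2 * α₄) ≤ 1)
    (hs₃ : C4G d L * (α₀ + 40 * d * c + 4 * (2 * α₄)) ≤ 1)
    (hs₄ : 1024 * ((d : ℝ) + 1) * ((d : ℝ) + 4) * L ^ 2 * α₀ ≤ 1) (hs₅ : 32 * ((d : ℝ) + 1) ^ 2 * C6 d * L ^ 2 * α₀ ≤ 1)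
    (hs₆ : 16 * d * C5' d * C6 d * (L : ℝ) ^ 2 * α₀ ≤ 1) (hs₇ : 8 * d * C6 d * L * α₀ ≤ 1)
    (hsm : 40 * d * c + α₄ ≤ 1 / (4 * B₀' * (2 * C2p d))) :
    ∃ (lam : Site d → 𝔸) (X : XSpace d k 𝔸),
      (∀ j, j ≤ k → ∀ y ∈ Λ j, ∀ x : Site d, InBox (tlo L y j) (thi L y j) x → ‖lam x‖ < α₄ / 2) ∧
      (∀ j, j ≤ k → ∀ y ∈ Λ j, ∀ (x : Site d) (κ : Fin d), InBox (tlo L y j) (thi L y j) x →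
        InBox (tlo L y j) (thi L y j) (x + e κ) → ‖cj (U₀ x κ) (lam (x + e κ)) - lam x‖ < α₄ / 2 * ((L : ℝ) ^ j)⁻¹) ∧
      ‖X‖ ≤ α₄ / (2 * B₀') ∧
      (∀ (j : ℕ) (hj : j ≤ k) (y : Site d), y ∉ Λ j → X (⟨j, Nat.lt_succ_of_le hj⟩, y) = 0) ∧
      (∀ (j : ℕ) (hj : j ≤ k) (y : Site d), y ∈ Λ j →
        Cnl L U₀ u₁ j (lam - H' X) y = X (⟨j, Nat.lt_succ_of_le hj⟩, y)) ∧
      lam - H' X = lam' := by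
  have hC2 : 0 ≤ C2p d := C2p_nonneg d
  have hC2pos : 0 < C2p d := by
    have hC6 : (2 : ℝ) ≤ C6 d := by unfold C6; linarith [one_le_C5 (d := d)]
    unfold C2p Cgen; positivity
  -- the smallness at `α₄` from the one at `2α₄`
  have hC6 : (0 : ℝ) ≤ C6 d := by unfold C6; linarith [one_le_C5 (d := d)]
  have hC4G : 0 ≤ C4G d L := by
    have h7 : (0 : ℝ) ≤ B7Prop10General.C7 d := by
      unfold B7Prop10General.C7 C6; linarith [one_le_C5 (d := d), C5'_nonneg (d := d)]
    have h4' := C4'_nonneg (d := d)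
    unfold C4G; positivity
  have hs₁' : 200 * C6 d * α₄ ≤ 1 :=
    (mul_le_mul_of_nonneg_left (by linarith only [hα₄]) (by positivity)).trans hs₁
  have hs₂' : 12000 * ((d : ℝ) + 1) * L * α₄ ≤ 1 :=
    (mul_le_mul_of_nonneg_left (by linarith only [hα₄]) (by positivity)).trans hs₂
  have hs₃' : C4G d L * (α₀ + 40 * d * c + 4 * α₄) ≤ 1 :=
    (mul_le_mul_of_nonneg_left (by linarith only [hα₄]) hC4G).trans hs₃
  -- print's smallness in product form: `C2p·(α₃ + α₄)·B′₀ ≤ 1/8`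
  have hprod : C2p d * (40 * d * c + α₄) * B₀' ≤ 1 / 8 := by
    have h1 : (40 * d * c + α₄) * (4 * B₀' * (2 * C2p d)) ≤ 1 := by
      have := mul_le_mul_of_nonneg_right hsm (by positivity : (0 : ℝ) ≤ 4 * B₀' * (2 * C2p d))
      rwa [one_div, inv_mul_cancel₀ (by positivity)] at this
    have e : C2p d * (40 * d * c + α₄) * B₀' = (40 * d * c + α₄) * (4 * B₀' * (2 * C2p d)) / 8 := by ring
    rw [e]
    linarith only [h1]
  -- `λ′` lies in the full-size set, so `X₀ = C′(λ′)|_{𝔅_k}` exists with the (1.121) bound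
  have hLj : ∀ j : ℕ, (0 : ℝ) < ((L : ℝ) ^ j)⁻¹ := fun j => by positivity
  have hb : ∀ j, j ≤ k → ∀ y ∈ Λ j, ∀ x : Site d, InBox (tlo L y j) (thi L y j) x → ‖lam' x‖ < α₄ :=
    fun j hj y hy x hx => (hq_b j hj y hy x hx).trans (by linarith only [hα₄])
  have ha : ∀ j, j ≤ k → ∀ y ∈ Λ j, ∀ (x : Site d) (κ : Fin d), InBox (tlo L y j) (thi L y j) x →
      InBox (tlo L y j) (thi L y j) (x + e κ) → ‖cj (U₀ x κ) (lam' (x + e κ)) - lam' x‖ < α₄ * ((L : ℝ) ^ j)⁻¹ :=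
    fun j hj y hy x κ hx hxe => (hq_a j hj y hy x κ hx hxe).trans_le
      (mul_le_mul_of_nonneg_right (by linarith only [hα₄]) (hLj j).le)
  obtain ⟨X₀, hX₀n, hX₀z, hX₀v⟩ := exists_masked_Cnl hL hL1 hG hU₀ k Λ lam' hα hα3 hα4 hc hα₄ h33 h69 hu₁ hb ha hsmall hc₃ hs
    hα₃' hs₁' hs₂' hs₃' hs₄ hs₅ hs₆ hs₇
  -- `B′₀‖X₀‖ ≤ α₄/8`
  have hBX : B₀' * ‖X₀‖ ≤ α₄ / 8 := by
    calc B₀' * ‖X₀‖ ≤ B₀' * (C2p d * (40 * d * c + α₄) * α₄) := mul_le_mul_of_nonneg_left hX₀n hB.le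
      _ = α₄ * (C2p d * (40 * d * c + α₄) * B₀') := by ring
      _ ≤ α₄ * (1 / 8) := mul_le_mul_of_nonneg_left hprod hα₄.le
      _ = α₄ / 8 := by ring
  have hX₀ball : ‖X₀‖ ≤ α₄ / (2 * B₀') := by
    rw [le_div_iff₀ (by positivity)]
    calc ‖X₀‖ * (2 * B₀') = 2 * (B₀' * ‖X₀‖) := by ring
      _ ≤ 2 * (α₄ / 8) := by linarith only [hBX]
      _ ≤ α₄ := by linarith only [hα₄]
  -- the explicit inverse `λ := λ′ + H′X₀`
  refine ⟨lam' + H' X₀, X₀, ?_, ?_, hX₀ball, hX₀z, ?_, by simp⟩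
  · -- sites: `|λ| < ¼α₄ + ⅛α₄ < ½α₄`
    intro j hj y hy x hx
    calc ‖(lam' + H' X₀) x‖ = ‖lam' x + H' X₀ x‖ := rfl
      _ ≤ ‖lam' x‖ + ‖H' X₀ x‖ := norm_add_le _ _
      _ ≤ ‖lam' x‖ + B₀' * ‖X₀‖ := by gcongr; exact hH0 X₀ x
      _ < α₄ / 4 + α₄ / 8 := by linarith only [hq_b j hj y hy x hx, hBX]
      _ ≤ α₄ / 2 := by linarith only [hα₄]
  · -- bonds: `|Dλ| < (¼α₄ + ⅛α₄)L^{−j} < ½α₄L^{−j}`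
    intro j hj y hy x κ hx hxe
    have hsplit : cj (U₀ x κ) ((lam' + H' X₀) (x + e κ)) - (lam' + H' X₀) x =
        (cj (U₀ x κ) (lam' (x + e κ)) - lam' x) + (cj (U₀ x κ) (H' X₀ (x + e κ)) - H' X₀ x) := by
      simp only [Pi.add_apply, cj_add]; abel
    rw [hsplit]
    calc ‖cj (U₀ x κ) (lam' (x + e κ)) - lam' x + (cj (U₀ x κ) (H' X₀ (x + e κ)) - H' X₀ x)‖
        ≤ ‖cj (U₀ x κ) (lam' (x + e κ)) - lam' x‖ + ‖cj (U₀ x κ) (H' X₀ (x + e κ)) - H' X₀ x‖ := norm_add_le _ _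
      _ ≤ ‖cj (U₀ x κ) (lam' (x + e κ)) - lam' x‖ + B₀' * ‖X₀‖ * ((L : ℝ) ^ j)⁻¹ := by
          gcongr; exact hH1 j hj y hy X₀ x κ hx hxe
      _ < α₄ / 4 * ((L : ℝ) ^ j)⁻¹ + α₄ / 8 * ((L : ℝ) ^ j)⁻¹ := by
          have := mul_le_mul_of_nonneg_right hBX (hLj j).le
          linarith only [hq_a j hj y hy x κ hx hxe, this]
      _ ≤ α₄ / 2 * ((L : ℝ) ^ j)⁻¹ := by
          have := (hLj j).le
          nlinarith only [this, hα₄]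
  · -- `X₀` solves (1.117) for `λ`: `λ − H′X₀ = λ′`
    intro j hj y hy
    rw [add_sub_cancel_right]
    exact (hX₀v j hj y hy).symm

/-- **THE ONTO SENTENCE AT `k` LEVELS FOR THE INDUCTIVE `u₁`** — `onto_kLevel` with `u₁ = glev_j on Bʲ(Λ_j)` discharged from
`U₁^{u₁}U₀ ∈ Ax_k(𝔅_k, U₀)` (`InAx`) and (1.29) for `u₁` (`Restr129`) (dag-n04-b's `B8Eq106Local.eq106_of_inAx_restr129` via
`B8Eq1117KLevel.glev_on_towers_of_axial`). [cite: Balaban1985RegularSpaces, p.97 (onto sentence), (1.19) p.79, (1.29) p.81, (1.68) p.88] -/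
theorem onto_kLevel_of_axial {L : ℕ} (hL : 2 ≤ L) (hL1 : 1 ≤ L) {G : Subgroup 𝔸ˣ} (hG : AvgClosed d L G)
    {U₀ : Site d → Fin d → 𝔸ˣ} (hU₀ : ∀ x κ, U₀ x κ ∈ G) {k : ℕ} (Λ : ℕ → Set (Site d))
    (H' : XSpace d k 𝔸 →ₗ[ℂ] (Site d → 𝔸)) (lam' : Site d → 𝔸) {B : Site d → Fin d → 𝔸} {u₁ : Site d → 𝔸ˣ}
    {α₀ α₄ c B₀' : ℝ}
    (hα : 0 < α₀) (hα3 : C0 d * α₀ ≤ 1 / 3) (hα4 : 4 * α₀ ≤ c2' d L) (hc : 0 ≤ c) (hα₄ : 0 < α₄) (hB : 0 < B₀')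
    (h33 : ∀ j, j ≤ k → ∀ y ∈ Λ j, pdevOn (tlo L y j) (thi L y j) U₀ < α₀ * (((L : ℝ) ^ j)⁻¹) ^ 2)
    (h69 : ∀ j, j ≤ k → ∀ y ∈ Λ j, ∀ (x : Site d) (κ : Fin d), InBox (tlo L y j) (thi L y j) x →
      InBox (tlo L y j) (thi L y j) (x + e κ) → ‖B x κ‖ ≤ c * ((L : ℝ) ^ j)⁻¹)
    (hAx : InAx L k Λ U₀ (mgauge U₀ u₁ (expCfg B) * U₀)) (h129 : Restr129 L k Λ U₀ u₁)
    (hq_b : ∀ j, j ≤ k → ∀ y ∈ Λ j, ∀ x : Site d, InBox (tlo L y j) (thi L y j) x → ‖lam' x‖ < α₄ / 4)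
    (hq_a : ∀ j, j ≤ k → ∀ y ∈ Λ j, ∀ (x : Site d) (κ : Fin d), InBox (tlo L y j) (thi L y j) x →
      InBox (tlo L y j) (thi L y j) (x + e κ) → ‖cj (U₀ x κ) (lam' (x + e κ)) - lam' x‖ < α₄ / 4 * ((L : ℝ) ^ j)⁻¹)
    (hH0 : ∀ (X : XSpace d k 𝔸) (x : Site d), ‖H' X x‖ ≤ B₀' * ‖X‖)
    (hH1 : ∀ j, j ≤ k → ∀ y ∈ Λ j, ∀ (X : XSpace d k 𝔸) (x : Site d) (κ : Fin d), InBox (tlo L y j) (thi L y j) x →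
      InBox (tlo L y j) (thi L y j) (x + e κ) → ‖cj (U₀ x κ) (H' X (x + e κ)) - H' X x‖ ≤ B₀' * ‖X‖ * ((L : ℝ) ^ j)⁻¹)
    (hsmall : Real.exp (4 * (800 * ((d : ℝ) + 1) ^ 2 * ((d : ℝ) + 4)) * α₀) * (1 + 8 * (131072 * ((d : ℝ) + 1) ^ 2) * c) ≤ 2)
    (hc₃ : 2 * c ≤ c3 d L) (hs : 128 * (d : ℝ) * c ≤ 1) (hα₃' : 40 * d * c ≤ 1 / 200)
    (hs₁ : 200 * C6 d * (2 * α₄) ≤ 1) (hs₂ : 12000 * ((d : ℝ) + 1) * L * (2 * α₄) ≤ 1)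
    (hs₃ : C4G d L * (α₀ + 40 * d * c + 4 * (2 * α₄)) ≤ 1)
    (hs₄ : 1024 * ((d : ℝ) + 1) * ((d : ℝ) + 4) * L ^ 2 * α₀ ≤ 1) (hs₅ : 32 * ((d : ℝ) + 1) ^ 2 * C6 d * L ^ 2 * α₀ ≤ 1)
    (hs₆ : 16 * d * C5' d * C6 d * (L : ℝ) ^ 2 * α₀ ≤ 1) (hs₇ : 8 * d * C6 d * L * α₀ ≤ 1)
    (hsm : 40 * d * c + α₄ ≤ 1 / (4 * B₀' * (2 * C2p d))) :
    ∃ (lam : Site d → 𝔸) (X : XSpace d k 𝔸),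
      (∀ j, j ≤ k → ∀ y ∈ Λ j, ∀ x : Site d, InBox (tlo L y j) (thi L y j) x → ‖lam x‖ < α₄ / 2) ∧
      (∀ j, j ≤ k → ∀ y ∈ Λ j, ∀ (x : Site d) (κ : Fin d), InBox (tlo L y j) (thi L y j) x →
        InBox (tlo L y j) (thi L y j) (x + e κ) → ‖cj (U₀ x κ) (lam (x + e κ)) - lam x‖ < α₄ / 2 * ((L : ℝ) ^ j)⁻¹) ∧
      ‖X‖ ≤ α₄ / (2 * B₀') ∧
      (∀ (j : ℕ) (hj : j ≤ k) (y : Site d), y ∉ Λ j → X (⟨j, Nat.lt_succ_of_le hj⟩, y) = 0) ∧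
      (∀ (j : ℕ) (hj : j ≤ k) (y : Site d), y ∈ Λ j →
        Cnl L U₀ u₁ j (lam - H' X) y = X (⟨j, Nat.lt_succ_of_le hj⟩, y)) ∧
      lam - H' X = lam' :=
  onto_kLevel hL hL1 hG hU₀ Λ H' lam' hα hα3 hα4 hc hα₄ hB h33 h69 (glev_on_towers_of_axial hL1 Λ hAx h129) hq_b hq_a hH0 hH1
    hsmall hc₃ hs hα₃' hs₁ hs₂ hs₃ hs₄ hs₅ hs₆ hs₇ hsm

/-! ## §3 (1.114) through the inverse: «changes the function Q′(λ′) into the linear function Q′λ» for EVERY `λ′` -/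

omit [NormOneClass 𝔸] in
/-- **(1.114) READ THROUGH THE EXPLICIT INVERSE** (p. 95: «the transformation λ′ = λ − H′D′(λ) (1.113) changes the function Q′(λ′) into the
linear function Q′λ»): if `X₀(j, y) = C′_j(u₁, λ′)(y)` on `𝔅_k` (the `X₀` of `exists_masked_Cnl` / `onto_kLevel`) and `Q′H′ = I` on `𝔅_k`
((1.91)), then for `λ := λ′ + H′X₀` one has `Q′_j(u₁, λ′)(y) = (Q′_jλ)(y)` for every `y ∈ Λ_j`, `j ≤ k` — the nonlinear constraint function
(1.79) at `λ′` is the LINEAR `Q′` at the preimage `λ` ((213) is the definition of `C′`; linearity of `Q′_j`).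
[cite: Balaban1985RegularSpaces, (1.113)–(1.116) pp.95–96, (1.79) p.90, (1.91) p.91; Balaban1985Averaging, (213) p.50] -/
theorem eq1114_inverse_kLevel {L k : ℕ} {U₀ : Site d → Fin d → 𝔸ˣ} {u₁ : Site d → 𝔸ˣ} (Λ : ℕ → Set (Site d))
    (H' : XSpace d k 𝔸 →ₗ[ℂ] (Site d → 𝔸)) {lam' : Site d → 𝔸} {X₀ : XSpace d k 𝔸}
    (hQH : ∀ (Y : XSpace d k 𝔸) (j : ℕ) (hj : j ≤ k) (y : Site d), y ∈ Λ j →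
      QprimeIter (zdBlocking d L) (bgT L U₀) j (H' Y) y = Y (⟨j, Nat.lt_succ_of_le hj⟩, y))
    (hX₀ : ∀ (j : ℕ) (hj : j ≤ k) (y : Site d), y ∈ Λ j → X₀ (⟨j, Nat.lt_succ_of_le hj⟩, y) = Cnl L U₀ u₁ j lam' y) :
    ∀ (j : ℕ), j ≤ k → ∀ y ∈ Λ j,
      Qnl L U₀ (fun x => expUnit (lam' x)) u₁ j y = QprimeIter (zdBlocking d L) (bgT L U₀) j (lam' + H' X₀) y := by
  intro j hj y hy
  -- (213): `Q′(u₁, λ′) = Q′λ′ + C′(λ′)` is the definition of `Cnl`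
  have h213 : Qnl L U₀ (fun x => expUnit (lam' x)) u₁ j y =
      QprimeIter (zdBlocking d L) (bgT L U₀) j lam' y + Cnl L U₀ u₁ j lam' y := by
    rw [Cnl]; abel
  -- linearity of `Q′_j` and `Q′H′ = I` on `𝔅_k`
  have hlin : QprimeIter (zdBlocking d L) (bgT L U₀) j (lam' + H' X₀) y =
      QprimeIter (zdBlocking d L) (bgT L U₀) j lam' y + QprimeIter (zdBlocking d L) (bgT L U₀) j (H' X₀) y := by
    have h1 : lam' + H' X₀ = lam' + (1 : ℂ) • H' X₀ := by rw [one_smul]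
    rw [h1, QprimeIter_line, one_smul]
  rw [h213, hlin, hQH X₀ j hj y hy, hX₀ j hj y hy]

#print axioms exists_masked_Cnl
#print axioms onto_kLevel
#print axioms onto_kLevel_of_axial
#print axioms eq1114_inverse_kLevel

end Literature.MathematicalPhysics.QuantumFieldTheory.Balaban1983to89.B8Claim97KLevel

end
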